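import Literature.MathematicalPhysics.QuantumFieldTheory.Balaban1983to89.B9Ineq349DPDsYOfEBlock
import Literature.MathematicalPhysics.QuantumFieldTheory.Balaban1983to89.B9CubeLettersCovarianceL0
import Literature.MathematicalPhysics.QuantumFieldTheory.Balaban1983to89.B9Cor36GCubeLocLetter

/-!
# `Balaban1983to89.B9Eq3105FamThreeLetters` — FAMILY 3 OF (3.105), `ζ_□̃·(DPD*(U₁) − DP_□D*)·h_□O_□h_□`, AT THE LETTERS — THE ALGEBRA: the transported cube
# projection IS `DP_□D*` at the gauged-back field ((3.33)–(3.34)), the derivative letters of both words AGREE under the cut-offs on the (3.35) window, and the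
# P-word difference TELESCOPES into three words carrying ONE letter difference each (`G′ − G′_□`, `Q′*X⁻¹Q′ − Q′*_□X_□⁻¹Q′_□`, `G′ − G′_□`); the transposed `hV′` word
# loses its `ζ` (sub-row G-B9-LETTERS, GAPS G-B9-05∕family 3, programme FAMTHREE FILE F3-A; lead g34 NEXT-ITEM RULING 2026-08-28 23:38Z; memo
# `lit-balaban-p33/g102/FAMTHREE-SCOPE.md`)

statement-level skeleton of published theorems with citation tags; proofs where landed; nothing here is a claim about the Yang–Mills mass gap

THE PRINTED LOCUS (verbatim, held `paper:balaban1985-cmp99-background-propagators`, journal page = PDF page + 388).  p. 414 (3.105), third sum: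
«− Σ_□ ζ_□̃(DPD* − DP_□D*)h_□G_□h_□»; p. 415 l.19–24 (text layer p0027): «Next we replace the operators G′_{□₀} and C_{□₀} by G′_□, C_□, terms with the
differences G′_{□₀} − G′_□ and C_{□₀} − C_□ are small by the same reason as before. … Using the fact that ζ_□̃h_□ = h_□ we get the following expression without
small factors ζ_□̃DG′_□Q′*C_□Q′G′_□D*h_□G_□h_□ = ζ_□̃DP_□D*h_□G_□h_□. This expression cancels the second term in the third sum.»; p. 394 (3.25) «Rf = (I −
G′Q′*(Q′G′²Q′*)⁻¹Q′G′)f»; p. 396 (3.33)–(3.34) («R(U^u) = R(u)R(U)R(u⁻¹)», «Δ_a(U^u) = R(u)Δ_a(U)R(u⁻¹)»); Cor. 3.6 p. 408 («U′ = U^u = e^{iηA}» on `Ω(□)` —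
the (3.35) window); (3.3) pp. 390–391, (3.8) p. 392 (the derivative letters read `U(b)` only).

WHY THIS FILE.  The consumer `B9Thm310DeltaAIsUnitOfExpansion.eBlock_kernelFamilyBInv_GAY_of_localInverseCubes''` displays family 3 of (3.105) in `hrest`,
`Σ_□ conj b((M_{ζ_□}·(DPDsY i parS G′ (cfg U₁) − Pl □)·(M_{h_□}·O_□·M_{h_□}))^ℝ)`, and its transposed word in `hV′`; at the located letters (G-F2)
`Pl □ = locProjBY i □ parS (u □) Ṽ_□ = R(u)⁻¹·DP_□D*(Ṽ_□)·R(u)`.  Programme FAMTHREE closes it on the FAMFOUR ∕ ZETA-2 standard (assemble at defined letters,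
per-cube letter-DIFFERENCE blocks displayed — memo §3 D1∕D2).  THIS FILE is the algebra every estimate file (F3-B∕C) starts from; no estimate here.

WHAT THIS FILE CERTIFIES (kernel-checked; 0 `def`, 0 `def … : Prop`, 0 sorry; standard axioms only)

* §1 ★ `DPDsCubeY_cov` ((3.33)–(3.34) for `DP_□D*`: `DP_□D*(U^g)·R(g) = R(g)·DP_□D*(U)`, gauge law of `parS` displayed as `IsGaugeLawS`), ★★ `locProjBY_eq_DPDsCubeY`:
  `Pl_□(g, Ṽ) = R(g)⁻¹·DP_□D*(Ṽ)·R(g) = DP_□D*(Ṽ^{g⁻¹})` — the transported cube projection IS the cube projection at the gauged-back field.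
* §2 ★ `cutMulY_mul_gradY_congr`, ★ `divY_mul_cutMulY_congr`, ★★ `cut_gradWdiv_cut_congr` — under a cut-off `M_f` the derivative letters `D_U`, `D*_U` read `U` only on
  the bonds issued from `supp f`; so two fields agreeing there give the same cut words (the (3.35) window replacement, exact — no small term).
* §3 ★ `comp3_sub_comp3` (telescoping `ASA′ − BS′B′ = (A−B)SA′ + BS(A′−B′) + B(S−S′)B′`), ★★ `famThree_word_eq`: under the window hypotheses,
  `M_ζ·(DPDsY parS G′ U − DPDsCubeY □ parS V′)·M_h = M_ζ·D_U·[(G′(U) − G′_□(V′))·S(U)·G′(U) + G′_□(V′)·S(U)·(G′(U) − G′_□(V′)) + G′_□(V′)·(S(U) − S_□(V′))·G′_□(V′)]·D*_U·M_h`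
  with `S = Q′*X⁻¹Q′`, `S_□ = Q′*_□X_□⁻¹Q′_□` ((3.25) for both words: Z2-P `id_sub_RY_eq`, here `id_sub_RCubeY_eq`); the cube sandwich `S_□` (weight `ℓ_□⁻⁴`,
  not transferable to the member carrier away from □) appears ONLY inside the difference `S − S_□`.
* §4 ★ `cutMulY_mul_cutMulY_eq_of_eq_one` (`M_h·M_ζ = M_h` whenever `ζ = 1` on `supp h` — the consumer's `hζ`), ★★ `famThreeT_word_eq`: the `hV′` word
  `M_h·O·M_h·(M_ζ·(DPDsY − Pl)) = M_h·O·M_h·(DPDsY − Pl)` (print p. 415 «ζ_□̃h_□ = h_□»).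

HONEST SCOPE ∕ NOT CLAIMED.  Algebra only (operator identities in def-Y's letters); no majorant, no smallness; `IsGaugeLawS i parS` displayed (a theorem for the
taxicab transporters `parSY`: `Node00.parSY_isGaugeLawS`; for `parSymY` in the tree's cube files); the window hypotheses are displayed in bond form (F3-C discharges
them from the (3.35) datum); the telescoping is OURS (print moves ζ_□̃ through the word instead — its commutator terms `[ζ_□̃, C_□]`, `[ζ_□̃, G′_□]` do not arise here).
Count-neutral; NOT a node discharge; no summit ∕ sub-problem statement is proved; nothing continuum ∕ OS ∕ mass-gap ∕ Clay; YM mass gap NOT proved (Track A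
conditional rung).  No `sorry`, no `axiom`, no `… : Prop` fact, no `instance`, no `notation`, no `def`.  NEW file; nothing landed is modified.  Cell `lit-balaban`,
seat `lit-balaban-p33` gen 102, 2026-08-28; `--supports stmt-QuantumFields-19200` as helper.  Net new unproved facts: 0.

RELATED IN THE TREE, NOT DUPLICATED (searched 2026-08-28: `rg 'DPDsCubeY_cov|locProjBY_eq|famThree'` = ∅): r05∕p21 `B9CubeLettersCovarianceL0` (`RCubeY_cov` …),
Node00 `OpsYGauge` (`gradY_cov`, `divY_cov`, `Intw.*`), `OpsYDeltaALocalAgree` (`gradY_apply_congr`, `divY_apply_congr`), G-F2 `B9Cor36GCubeLocLetter` (`locProjBY`),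
p33 Z2-P `B9Ineq349DPDsYOfEBlock` (`id_sub_RY_eq`), `B9Eq3105AtLetters` (`DPDsCubeY`) — all USED BY NAME.
-/

noncomputable section

namespace Literature.MathematicalPhysics.QuantumFieldTheory.Balaban1983to89.B9Eq3105FamThreeLetters

open NormedSpace Complex
open B6KLevelCensusIndexV1 (KIdx)
open B6Cover236MultiLevelBlocks (cubes)
open B9Thm37CubeCoverCommutators (cutMulY cutMulY_apply hTY)
open B9Eq3104CutoffCommutators (hBdY DPDsY)
open B9Eq3105AtLetters (DPDsCubeY)
open B9CubeLettersOpsL0 (GpCubeY)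
open B9CubeLettersBondOpsL0 (QpCubeY QpsCubeY XinvCubeY RCubeY)
open B9CubeLettersCovarianceL0 (RCubeY_cov)
open B9Cor36GCubeLocLetter (locProjBY)
open B9Ineq349DPDsYOfEBlock (id_sub_RY_eq)
open Node00 (SiteY FBondY CfgY GaugeY SiteOpY BondOpY SiteParY toKT QpY QpsY XinvY RY gradY divY gradK divK conjY gaugeY gSiteY gBondY Intw IsGaugeLawS
  gradY_cov divY_cov conjY_mul conjY_one)
open Node00.OpsYDeltaALocalAgree (gradY_apply_congr divY_apply_congr)

variable {d ℓ : ℕ} {hd : 1 ≤ d + 1} {hL : Odd (ℓ + 1) ∧ 1 < ℓ + 1} {b₀ b₁ : ℝ}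
variable {𝔸 : Type} [NormedRing 𝔸] [NormedAlgebra ℂ 𝔸] [CompleteSpace 𝔸]
variable (i : KIdx d ℓ hd hL b₀ b₁) (c : ↥(cubes (toKT i).D.toDomains)) (parS : SiteParY 𝔸 i)

/-! ## §1  (3.33)–(3.34) for `DP_□D*`; the transported cube projection is `DP_□D*` at the gauged-back field -/

section Covariance

/-- ★ **(3.34) FOR `DP_□D*`**: `DP_□D*(U^g)·R(g) = R(g)·DP_□D*(U)` on bond functions (`R(g) = conjY (gBondY i g)`), for a gauge-law `parS`.
[cite: Balaban1985BackgroundPropagators, (3.33)–(3.34) p.396, (3.25) p.394, p.409 l.3–5] -/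
theorem DPDsCubeY_cov {parS : SiteParY 𝔸 i} (hS : IsGaugeLawS i parS) (g : GaugeY 𝔸 i) (U : CfgY 𝔸 i) :
    Intw (conjY (gBondY i g)) (conjY (gBondY i g)) (DPDsCubeY i c parS U) (DPDsCubeY i c parS (gaugeY i g U)) :=
  (gradY_cov i g U).comp ((Intw.id.sub (RCubeY_cov c hS)).comp (divY_cov i g U))

/-- pointwise: `gBondY i g⁻¹ = (gBondY i g)⁻¹`. [cite: Balaban1985BackgroundPropagators, (3.28) p.395, bookkeeping] -/
theorem gBondY_inv (g : GaugeY 𝔸 i) : gBondY i g⁻¹ = (gBondY i g)⁻¹ := rfl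

/-- `R(g⁻¹)·R(g) = 1` on bond functions. [cite: Balaban1985BackgroundPropagators, (3.28) p.395, bookkeeping] -/
theorem conjY_gBondY_inv_comp (g : GaugeY 𝔸 i) : conjY (gBondY i g⁻¹) ∘ₗ conjY (gBondY i g) = LinearMap.id := by
  rw [← conjY_mul, gBondY_inv, inv_mul_cancel, conjY_one]

/-- ★★ **`Pl_□ = R(g)⁻¹·DP_□D*(Ṽ)·R(g) = DP_□D*(Ṽ^{g⁻¹})`** — G-F2's transported cube projection IS the cube projection at the gauged-back field.
[cite: Balaban1985BackgroundPropagators, (3.105) p.414, (3.33)–(3.34) p.396, Cor. 3.6 p.408] -/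
theorem locProjBY_eq_DPDsCubeY {parS : SiteParY 𝔸 i} (hS : IsGaugeLawS i parS) (g : GaugeY 𝔸 i) (V : CfgY 𝔸 i) :
    locProjBY i c parS g V = DPDsCubeY i c parS (gaugeY i g⁻¹ V) := by
  have h := DPDsCubeY_cov i c hS g⁻¹ V
  rw [Intw] at h
  rw [locProjBY, ← gBondY_inv, Module.End.mul_eq_comp, Module.End.mul_eq_comp, ← h, LinearMap.comp_assoc, conjY_gBondY_inv_comp,
    LinearMap.comp_id]

end Covariance

/-! ## §2  The (3.35) window: under a cut-off the derivative letters read the field only on the bonds issued from the cut-off's support -/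

section Window

/-- ★ `M_f·D_U = M_f·D_{U′}` when `U = U′` on every bond `b` with `f(b) ≠ 0` ((3.3): `(D_Uλ)(b)` reads `U(b)` only).
[cite: Balaban1985BackgroundPropagators, (3.3) pp.390–391, Cor. 3.6 p.408 (the window)] -/
theorem cutMulY_mul_gradY_congr (f : FBondY i → ℝ) {U U' : CfgY 𝔸 i} (h : ∀ b : FBondY i, f b ≠ 0 → U b.dir b.src = U' b.dir b.src) :
    cutMulY (𝔸 := 𝔸) f ∘ₗ gradY i U = cutMulY (𝔸 := 𝔸) f ∘ₗ gradY i U' := by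
  refine LinearMap.ext fun Λ => funext fun b => ?_
  simp only [LinearMap.comp_apply, cutMulY_apply]
  by_cases hf : f b = 0
  · rw [hf, Complex.ofReal_zero, zero_smul, zero_smul]
  · rw [gradY_apply_congr (h b hf) (fun _ _ => rfl)]

/-- ★ `D*_U·M_f = D*_{U′}·M_f` when `U = U′` on every bond `b` with `f(b) ≠ 0` ((3.8): `(D*_UA)(z)` reads `U(b)` only where `A(b) ≠ 0`).
[cite: Balaban1985BackgroundPropagators, (3.8) p.392, Cor. 3.6 p.408] -/
theorem divY_mul_cutMulY_congr (f : FBondY i → ℝ) {U U' : CfgY 𝔸 i} (h : ∀ b : FBondY i, f b ≠ 0 → U b.dir b.src = U' b.dir b.src) :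
    divY i U ∘ₗ cutMulY (𝔸 := 𝔸) f = divY i U' ∘ₗ cutMulY (𝔸 := 𝔸) f := by
  refine LinearMap.ext fun Λ => funext fun z => ?_
  simp only [LinearMap.comp_apply]
  refine divY_apply_congr fun b _ => ⟨rfl, fun hb => h b fun hf => hb ?_⟩
  rw [cutMulY_apply, hf, Complex.ofReal_zero, zero_smul]

/-- ★★ **THE WINDOW REPLACEMENT**: `M_f·(D_U·W·D*_U)·M_h = M_f·(D_{U′}·W·D*_{U′})·M_h` for any site word `W`, when `U = U′` on the bonds issued from `supp f` and
from `supp h`. [cite: Balaban1985BackgroundPropagators, (3.3) pp.390–391, (3.8) p.392, Cor. 3.6 p.408 («U′ = U^u = e^{iηA}» on `Ω(□)`)] -/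
theorem cut_gradWdiv_cut_congr (f h : FBondY i → ℝ) (W : (SiteY i → 𝔸) →ₗ[ℂ] (SiteY i → 𝔸)) {U U' : CfgY 𝔸 i}
    (hf : ∀ b : FBondY i, f b ≠ 0 → U b.dir b.src = U' b.dir b.src) (hh : ∀ b : FBondY i, h b ≠ 0 → U b.dir b.src = U' b.dir b.src) :
    cutMulY (𝔸 := 𝔸) f ∘ₗ (gradY i U ∘ₗ W ∘ₗ divY i U) ∘ₗ cutMulY (𝔸 := 𝔸) h =
      cutMulY (𝔸 := 𝔸) f ∘ₗ (gradY i U' ∘ₗ W ∘ₗ divY i U') ∘ₗ cutMulY (𝔸 := 𝔸) h := by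
  calc cutMulY (𝔸 := 𝔸) f ∘ₗ (gradY i U ∘ₗ W ∘ₗ divY i U) ∘ₗ cutMulY (𝔸 := 𝔸) h
      = (cutMulY (𝔸 := 𝔸) f ∘ₗ gradY i U) ∘ₗ W ∘ₗ (divY i U ∘ₗ cutMulY (𝔸 := 𝔸) h) := by simp only [LinearMap.comp_assoc]
    _ = (cutMulY (𝔸 := 𝔸) f ∘ₗ gradY i U') ∘ₗ W ∘ₗ (divY i U' ∘ₗ cutMulY (𝔸 := 𝔸) h) := by
        rw [cutMulY_mul_gradY_congr i f hf, divY_mul_cutMulY_congr i h hh]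
    _ = cutMulY (𝔸 := 𝔸) f ∘ₗ (gradY i U' ∘ₗ W ∘ₗ divY i U') ∘ₗ cutMulY (𝔸 := 𝔸) h := by simp only [LinearMap.comp_assoc]

end Window

/-! ## §3  (3.25) for both words and the three-term telescoping -/

section Telescope

/-- `1 − R_□(U) = G′_□Q′*_□X_□⁻¹Q′_□G′_□ (U)` — (3.25) for the cube sequence. [cite: Balaban1985BackgroundPropagators, (3.25) p.394, p.409 l.1–5] -/
theorem id_sub_RCubeY_eq (U : CfgY 𝔸 i) :
    LinearMap.id - RCubeY i c parS U =
      GpCubeY i c parS U ∘ₗ QpsCubeY i c parS U ∘ₗ XinvCubeY i c parS U ∘ₗ QpCubeY i c parS U ∘ₗ GpCubeY i c parS U := by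
  rw [RCubeY, sub_sub_cancel]

omit [CompleteSpace 𝔸] in
/-- ★ **TELESCOPING**: `A·S·A′ − B·S′·B′ = (A − B)·S·A′ + B·S·(A′ − B′) + B·(S − S′)·B′` for linear maps — one difference per term, and the cube sandwich `S′` NEVER bare (it only enters through `S − S′`).
[cite: Balaban1985BackgroundPropagators, p.415 l.19–22 (replace the letters one at a time), bookkeeping] -/
theorem comp3_sub_comp3 {M N : Type} [AddCommGroup M] [Module ℂ M] [AddCommGroup N] [Module ℂ N]
    (A B : M →ₗ[ℂ] M) (S S' : M →ₗ[ℂ] M) (A' B' : N →ₗ[ℂ] M) :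
    A ∘ₗ S ∘ₗ A' - B ∘ₗ S' ∘ₗ B' = (A - B) ∘ₗ S ∘ₗ A' + B ∘ₗ S ∘ₗ (A' - B') + B ∘ₗ (S - S') ∘ₗ B' := by
  simp only [LinearMap.sub_comp, LinearMap.comp_sub]
  abel

/-- ★★ **THE FAMILY-3 WORD AT THE LETTERS**: under the window hypotheses (the cube word's field `V′` agrees with `U` on the bonds issued from `supp ζ♭` and `supp h♭`),
`M_ζ·(DPDsY parS G′ U − DPDsCubeY □ parS V′)·M_h = M_ζ·D_U·[(G′(U) − G′_□(V′))·S(U)·G′(U) + G′_□(V′)·S(U)·(G′(U) − G′_□(V′)) + G′_□(V′)·(S(U) − S_□(V′))·G′_□(V′)]·D*_U·M_h`,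
`S = Q′*X⁻¹Q′ (U)`, `S_□ = Q′*_□X_□⁻¹Q′_□ (V′)` — ONE letter difference per term and the cube sandwich `S_□` never bare (the located form of p. 415's «terms with the
differences G′_{□₀} − G′_□ and C_{□₀} − C_□»).
[cite: Balaban1985BackgroundPropagators, (3.105) p.414, p.415 l.19–24, (3.25) p.394, (3.3) pp.390–391, (3.8) p.392, Cor. 3.6 p.408] -/
theorem famThree_word_eq (Gp : SiteOpY 𝔸 i) (U V' : CfgY 𝔸 i) (ζb hb : FBondY i → ℝ)
    (hζ : ∀ b : FBondY i, ζb b ≠ 0 → V' b.dir b.src = U b.dir b.src) (hh : ∀ b : FBondY i, hb b ≠ 0 → V' b.dir b.src = U b.dir b.src) :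
    cutMulY (𝔸 := 𝔸) ζb ∘ₗ (DPDsY i parS Gp U - DPDsCubeY i c parS V') ∘ₗ cutMulY (𝔸 := 𝔸) hb =
      cutMulY (𝔸 := 𝔸) ζb ∘ₗ (gradY i U ∘ₗ
        ((Gp U - GpCubeY i c parS V') ∘ₗ (QpsY i parS U ∘ₗ XinvY i parS Gp U ∘ₗ QpY i parS U) ∘ₗ Gp U
          + GpCubeY i c parS V' ∘ₗ (QpsY i parS U ∘ₗ XinvY i parS Gp U ∘ₗ QpY i parS U) ∘ₗ (Gp U - GpCubeY i c parS V')
          + GpCubeY i c parS V' ∘ₗ ((QpsY i parS U ∘ₗ XinvY i parS Gp U ∘ₗ QpY i parS U)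
              - (QpsCubeY i c parS V' ∘ₗ XinvCubeY i c parS V' ∘ₗ QpCubeY i c parS V')) ∘ₗ GpCubeY i c parS V')
        ∘ₗ divY i U) ∘ₗ cutMulY (𝔸 := 𝔸) hb := by
  -- the cube word with its derivative letters moved to `U` (window)
  have hw : cutMulY (𝔸 := 𝔸) ζb ∘ₗ DPDsCubeY i c parS V' ∘ₗ cutMulY (𝔸 := 𝔸) hb =
      cutMulY (𝔸 := 𝔸) ζb ∘ₗ (gradY i U ∘ₗ (LinearMap.id - RCubeY i c parS V') ∘ₗ divY i U) ∘ₗ cutMulY (𝔸 := 𝔸) hb := by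
    rw [DPDsCubeY]
    exact cut_gradWdiv_cut_congr i ζb hb _ hζ hh
  have e1 : cutMulY (𝔸 := 𝔸) ζb ∘ₗ (DPDsY i parS Gp U - DPDsCubeY i c parS V') ∘ₗ cutMulY (𝔸 := 𝔸) hb =
      cutMulY (𝔸 := 𝔸) ζb ∘ₗ DPDsY i parS Gp U ∘ₗ cutMulY (𝔸 := 𝔸) hb - cutMulY (𝔸 := 𝔸) ζb ∘ₗ DPDsCubeY i c parS V' ∘ₗ cutMulY (𝔸 := 𝔸) hb := by
    simp only [LinearMap.comp_sub, LinearMap.sub_comp]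
  rw [e1, hw, DPDsY, id_sub_RY_eq, id_sub_RCubeY_eq]
  simp only [LinearMap.sub_comp, LinearMap.comp_sub, LinearMap.add_comp, LinearMap.comp_add, LinearMap.comp_assoc]
  abel

end Telescope

/-! ## §4  The transposed `hV′` word loses its `ζ` (`ζh = h`) -/

section Transposed

omit [CompleteSpace 𝔸] in
/-- ★ `M_h·M_ζ = M_h` whenever `ζ = 1` on `supp h` (the consumer's `hζ`, read on bonds). [cite: Balaban1985BackgroundPropagators, p.415 («ζ_□̃h_□ = h_□»), (3.105) p.414] -/
theorem cutMulY_mul_cutMulY_eq_of_eq_one (hb ζb : FBondY i → ℝ) (h1 : ∀ b : FBondY i, hb b ≠ 0 → ζb b = 1) :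
    cutMulY (𝔸 := 𝔸) hb ∘ₗ cutMulY (𝔸 := 𝔸) ζb = cutMulY (𝔸 := 𝔸) hb := by
  refine LinearMap.ext fun Λ => funext fun b => ?_
  simp only [LinearMap.comp_apply, cutMulY_apply, smul_smul, ← Complex.ofReal_mul]
  by_cases h0 : hb b = 0
  · rw [h0, zero_mul]
  · rw [h1 b h0, mul_one]

omit [CompleteSpace 𝔸] in
/-- site-to-bond form of the consumer's `hζ : ∀ z, hTY i □ z ≠ 0 → ζ z = 1`. [cite: Balaban1985BackgroundPropagators, p.415, bookkeeping] -/
theorem hBdY_eq_one_of_hTY (ζ : SiteY i → ℝ) (c' : ↥(cubes i.D.toDomains)) (hζ : ∀ z, hTY i c' z ≠ 0 → ζ z = 1) (b : FBondY i)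
    (hb : hBdY i (hTY i c') b ≠ 0) : hBdY i ζ b = 1 :=
  hζ _ hb

omit [CompleteSpace 𝔸] in
/-- ★★ **THE TRANSPOSED FAMILY-3 WORD OF `hV′` LOSES ITS ζ**: `M_h·O·M_h·(M_ζ·(P − Pl)) = M_h·O·M_h·(P − Pl)` when `ζ = 1` on `supp h_□`.
[cite: Balaban1985BackgroundPropagators, (3.105) p.414, p.415 («Using the fact that ζ_□̃h_□ = h_□»)] -/
theorem famThreeT_word_eq (c' : ↥(cubes i.D.toDomains)) (ζ : SiteY i → ℝ) (hζ : ∀ z, hTY i c' z ≠ 0 → ζ z = 1)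
    (O P Pl : (FBondY i → 𝔸) →ₗ[ℂ] (FBondY i → 𝔸)) :
    cutMulY (𝔸 := 𝔸) (hBdY i (hTY i c')) * O * cutMulY (𝔸 := 𝔸) (hBdY i (hTY i c')) * (cutMulY (𝔸 := 𝔸) (hBdY i ζ) * (P - Pl)) =
      cutMulY (𝔸 := 𝔸) (hBdY i (hTY i c')) * O * cutMulY (𝔸 := 𝔸) (hBdY i (hTY i c')) * (P - Pl) := by
  rw [← mul_assoc, mul_assoc (cutMulY (𝔸 := 𝔸) (hBdY i (hTY i c')) * O) (cutMulY (𝔸 := 𝔸) (hBdY i (hTY i c'))) (cutMulY (𝔸 := 𝔸) (hBdY i ζ)),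
    Module.End.mul_eq_comp (cutMulY (𝔸 := 𝔸) (hBdY i (hTY i c'))) (cutMulY (𝔸 := 𝔸) (hBdY i ζ)),
    cutMulY_mul_cutMulY_eq_of_eq_one i _ _ (hBdY_eq_one_of_hTY i ζ c' hζ)]

end Transposed

end Literature.MathematicalPhysics.QuantumFieldTheory.Balaban1983to89.B9Eq3105FamThreeLetters

end
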